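import Literature.Computability.Cryptography.ImpagliazzoLevinOWF
import Literature.Computability.Cryptography.AffineHashProgram
import Literature.Computability.Complexity.PlumbingBricks
import Literature.Computability.Complexity.LengthCompare
import HarnessLib

/-!
# Impagliazzo–Levin inversion, IV: the verifier of `L_f` is polynomial time (`Params.Rel ∈ P`)

The first efficiency statement of `ImpagliazzoLevinAnalysis.lean`: for polynomial-time `f`, the
verifier relation `Params.Rel` of the language `L_f` of the reduction (`ImpagliazzoLevinOWF.lean`:
on `⟨z, r⟩` with `n = |r|`, decode `(b, i)` from `(|r|, |z|)`, then check `h(pad(f r)) = v`,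
`g(r) = 0^b`, `r_i = 1`) is in `P` (`Rel_mem_P`), hence `L_f ∈ NP` (`Lang_mem_NP`).

As in `AffineHashProgram.lean` / `YaoInvProgram.lean`, no machine is programmed: the checker is a
pipeline of existing `FP` bricks — unary evaluation of the size polynomials (`Plumb.polyFn`), the
length tests `lenLeFn`, division with remainder in unary (`Plumb.divModFn`), field extraction
(`Plumb.takeFn` / `Plumb.dropFn`), the `10^*` padding (`Plumb.pad10Fn`), the string-keyed affine
hash (`AffineProg.hashFn`), zeros (`Kannan.zerosFn`), the bit read (`HashBricks.headBitFn`) and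
comparisons (`eqPairFn`, `Brick.andFn`) — whose value on every word is the Boolean
`[RelPred z r]` (`chkFn_apply`), and `mem_P_of_mem_FP` concludes.

## References

* A. Bogdanov, L. Trevisan, *Average-Case Complexity*, ECCC TR06-073 (2006), §5.1.3 (the machine
  `M`: "guess `r` … such that `h(S(n; r)) = y` and `g(r) = 0`", polynomial time).
* S. Arora, B. Barak, *Computational Complexity: A Modern Approach*, CUP 2009, §1.3, Def. 2.1.
-/

namespace Literature.Computability.Cryptography

namespace ImpagliazzoLevin

open _root_.Computability Polynomial Complexity Complexity.Nondeterministic Complexity.Plumb Complexity.Brick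
  Complexity.OracleCompose Complexity.HashBricks AffineStr AffineProg

namespace Params

variable (P : Params)

/-! ### The size polynomials -/

/-- `L_g(n) = (n+2)(n+1)` as a polynomial. [folklore] -/
noncomputable def LgPoly : Polynomial ℕ := (X + 2) * (X + 1)

/-- `L_h(n) = (n+4)(p(n)+2)` as a polynomial. [folklore] -/
noncomputable def LhPoly : Polynomial ℕ := (X + 4) * (P.p + 2)

/-- `T(n) = L_h + L_g + (n+4) + n²(n+3)` as a polynomial. [folklore] -/
noncomputable def TlPoly : Polynomial ℕ := P.LhPoly + LgPoly + (X + 4) + X ^ 2 * (X + 3)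

/-- `LgPoly` evaluates to `Lg`. [folklore] -/
@[simp] theorem eval_LgPoly (n : ℕ) : LgPoly.eval n = Lg n := by simp [LgPoly, Lg]

/-- `LhPoly` evaluates to `Lh`. [folklore] -/
@[simp] theorem eval_LhPoly (n : ℕ) : P.LhPoly.eval n = P.Lh n := by simp [LhPoly, Lh, Pd]

/-- `TlPoly` evaluates to `Tl`. [folklore] -/
@[simp] theorem eval_TlPoly (n : ℕ) : P.TlPoly.eval n = P.Tl n := by simp [TlPoly, Tl, W]

/-! ### The checker pipeline on `w = ⟨z, r⟩` -/

/-- `1ⁿ`, `n = |r|`. [folklore] -/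
noncomputable def uF : List Bool → List Bool := onesFn ∘ sndF
/-- `1^{T(n)}`. [folklore] -/
noncomputable def tlF : List Bool → List Bool := polyFn P.TlPoly ∘ uF
/-- `z ⇂ T(n)` (of length `|z| - T(n)`). [folklore] -/
noncomputable def dF : List Bool → List Bool := dropFn ∘ fanoutFn P.tlF fstF
/-- `⟨1^i, 1^b⟩ = divMod (|z| - T(n)) (n + 3)`. [folklore] -/
noncomputable def dmF : List Bool → List Bool := divModFn ∘ fanoutFn (polyFn (X + 3) ∘ uF) (onesFn ∘ P.dF)
/-- `1^i`. [folklore] -/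
noncomputable def iF : List Bool → List Bool := fstF ∘ P.dmF
/-- `1^b`. [folklore] -/
noncomputable def bF : List Bool → List Bool := sndF ∘ P.dmF
/-- `1^{n+4-b}`. [folklore] -/
noncomputable def aF : List Bool → List Bool := dropFn ∘ fanoutFn P.bF (polyFn (X + 4) ∘ uF)
/-- `1^{L_h(n)}`. [folklore] -/
noncomputable def lhF : List Bool → List Bool := polyFn P.LhPoly ∘ uF
/-- `1^{L_g(n)}`. [folklore] -/
noncomputable def lgF : List Bool → List Bool := polyFn LgPoly ∘ uF
/-- The `h`-key `z ↾ L_h`. [folklore] -/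
noncomputable def keyHF : List Bool → List Bool := takeFn ∘ fanoutFn P.lhF fstF
/-- The `g`-key `(z ⇂ L_h) ↾ L_g`. [folklore] -/
noncomputable def keyGF : List Bool → List Bool := takeFn ∘ fanoutFn lgF (dropFn ∘ fanoutFn P.lhF fstF)
/-- The `v`-field `(z ⇂ (L_h + L_g)) ↾ (n + 4 - b)`. [folklore] -/
noncomputable def vF : List Bool → List Bool :=
  takeFn ∘ fanoutFn P.aF (dropFn ∘ fanoutFn (concatFn ∘ fanoutFn P.lhF lgF) fstF)
/-- The padded image `pad_n(f r)`. [folklore] -/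
noncomputable def padF : List Bool → List Bool := pad10Fn ∘ fanoutFn (polyFn P.p ∘ uF) (P.f ∘ sndF)
/-- `h(pad(f r))`. [folklore] -/
noncomputable def hHF : List Bool → List Bool :=
  hashFn ∘ fanoutFn (fanoutFn (polyFn (P.p + 1) ∘ uF) P.aF) (fanoutFn P.keyHF P.padF)
/-- `g(r)`. [folklore] -/
noncomputable def hGF : List Bool → List Bool := hashFn ∘ fanoutFn (fanoutFn uF P.bF) (fanoutFn P.keyGF sndF)
/-- `[T(n) ≤ |z|]`. [folklore] -/
noncomputable def c1F : List Bool → List Bool := lenLeFn X ∘ fanoutFn fstF P.tlF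
/-- `[i < n]`. [folklore] -/
noncomputable def c2F : List Bool → List Bool := lenLeFn X ∘ fanoutFn uF (List.cons true ∘ P.iF)
/-- `[h(pad(f r)) = v]`. [folklore] -/
noncomputable def c3F : List Bool → List Bool := eqPairFn ∘ fanoutFn P.hHF P.vF
/-- `[g(r) = 0^b]`. [folklore] -/
noncomputable def c4F : List Bool → List Bool := eqPairFn ∘ fanoutFn P.hGF (Kannan.zerosFn ∘ P.bF)
/-- `[r_i = 1]`. [folklore] -/
noncomputable def c5F : List Bool → List Bool := headBitFn ∘ dropFn ∘ fanoutFn P.iF sndF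
/-- **The checker**: the conjunction of the five tests. [Bogdanov–Trevisan 2006, §5.1.3 (machine `M`)]
[folklore] -/
noncomputable def chkFn : List Bool → List Bool := andFn P.c1F (andFn P.c2F (andFn P.c3F (andFn P.c4F P.c5F)))

/-! ### Values -/

section Values

variable (w : List Bool)

/-- `unaryEncodeNat n = ones n`. [folklore] -/
private theorem unaryEncodeNat_ones (m : ℕ) : unaryEncodeNat m = ones m := Complexity.unaryEncodeNat_eq_replicate m

/-- `uF w = 1^{|r|}`. [folklore] -/
theorem uF_apply : uF w = ones (sndF w).length := by simp [uF, onesFn, unaryEncodeNat_ones]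

/-- `tlF w = 1^{T(n)}`. [folklore] -/
theorem tlF_apply : P.tlF w = ones (P.Tl (sndF w).length) := by
  simp [tlF, uF_apply, polyFn_apply]

/-- `|dF w| = |z| - T(n)`. [folklore] -/
theorem length_dF : (P.dF w).length = (fstF w).length - P.Tl (sndF w).length := by
  simp [dF, tlF_apply]

/-- `dmF w = ⟨1^i, 1^b⟩`. [folklore] -/
theorem dmF_apply : P.dmF w = boolPair (ones (((fstF w).length - P.Tl (sndF w).length) / ((sndF w).length + 3)))
    (ones (((fstF w).length - P.Tl (sndF w).length) % ((sndF w).length + 3))) := by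
  simp only [dmF, Function.comp_apply, fanoutFn_apply, polyFn_apply, uF_apply, List.length_replicate, eval_add, eval_X,
    eval_ofNat, onesFn, unaryEncodeNat_ones, length_dF]
  exact divModFn_boolPair _ _

/-- `iF w = 1^i`. [folklore] -/
theorem iF_apply : P.iF w = ones (((fstF w).length - P.Tl (sndF w).length) / ((sndF w).length + 3)) := by
  simp [iF, dmF_apply]

/-- `bF w = 1^b`. [folklore] -/
theorem bF_apply : P.bF w = ones (((fstF w).length - P.Tl (sndF w).length) % ((sndF w).length + 3)) := by
  simp [bF, dmF_apply]

/-- `aF w = 1^{n+4-b}`. [folklore] -/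
theorem aF_apply : P.aF w = ones ((sndF w).length + 4 - ((fstF w).length - P.Tl (sndF w).length) % ((sndF w).length + 3)) := by
  simp [aF, bF_apply, uF_apply, polyFn_apply, ones, List.drop_replicate]

/-- `lhF w = 1^{L_h(n)}`. [folklore] -/
theorem lhF_apply : P.lhF w = ones (P.Lh (sndF w).length) := by simp [lhF, uF_apply, polyFn_apply]

/-- `lgF w = 1^{L_g(n)}`. [folklore] -/
theorem lgF_apply : lgF w = ones (Lg (sndF w).length) := by simp [lgF, uF_apply, polyFn_apply]

/-- `keyHF w = keyH n z`. [folklore] -/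
theorem keyHF_apply : P.keyHF w = P.keyH (sndF w).length (fstF w) := by
  simp [keyHF, lhF_apply, keyH]

/-- `keyGF w = keyG n z`. [folklore] -/
theorem keyGF_apply : P.keyGF w = P.keyG (sndF w).length (fstF w) := by
  simp [keyGF, lhF_apply, lgF_apply, keyG]

/-- `vF w = vf n b z`. [folklore] -/
theorem vF_apply : P.vF w = P.vf (sndF w).length (((fstF w).length - P.Tl (sndF w).length) % ((sndF w).length + 3)) (fstF w) := by
  simp [vF, aF_apply, lhF_apply, lgF_apply, vf, ones]

/-- `padF w = pad_n(f r)`. [folklore] -/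
theorem padF_apply : P.padF w = P.pad (sndF w).length (P.f (sndF w)) := by
  simp [padF, uF_apply, polyFn_apply, pad]

/-- `hHF w = h(pad(f r))`. [folklore] -/
theorem hHF_apply : P.hHF w = P.hH (sndF w).length (((fstF w).length - P.Tl (sndF w).length) % ((sndF w).length + 3))
    (P.keyH (sndF w).length (fstF w)) (P.pad (sndF w).length (P.f (sndF w))) := by
  simp only [hHF, Function.comp_apply, fanoutFn_apply, polyFn_apply, uF_apply, List.length_replicate, eval_add, eval_one,
    aF_apply, keyHF_apply, padF_apply, hH, Pd]
  exact hashFn_boolPair _ _ _ _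

/-- `hGF w = g(r)`. [folklore] -/
theorem hGF_apply : P.hGF w = hG (sndF w).length (((fstF w).length - P.Tl (sndF w).length) % ((sndF w).length + 3))
    (P.keyG (sndF w).length (fstF w)) (sndF w) := by
  simp only [hGF, Function.comp_apply, fanoutFn_apply, uF_apply, bF_apply, keyGF_apply, hG]
  exact hashFn_boolPair _ _ _ _

/-- `c1F w = [T(n) ≤ |z|]`. [folklore] -/
theorem c1F_apply : P.c1F w = [decide (P.Tl (sndF w).length ≤ (fstF w).length)] := by
  simp [c1F, tlF_apply, lenLeFn_boolPair]

/-- `c2F w = [i < n]`. [folklore] -/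
theorem c2F_apply : P.c2F w = [decide (((fstF w).length - P.Tl (sndF w).length) / ((sndF w).length + 3) < (sndF w).length)] := by
  simp only [c2F, Function.comp_apply, fanoutFn_apply, uF_apply, iF_apply, lenLeFn_boolPair, List.length_cons, List.length_replicate,
    eval_X]
  rfl

/-- `c3F w = [h(pad(f r)) = v]`. [folklore] -/
theorem c3F_apply : P.c3F w = [decide (P.hH (sndF w).length (((fstF w).length - P.Tl (sndF w).length) % ((sndF w).length + 3))
    (P.keyH (sndF w).length (fstF w)) (P.pad (sndF w).length (P.f (sndF w))) =
      P.vf (sndF w).length (((fstF w).length - P.Tl (sndF w).length) % ((sndF w).length + 3)) (fstF w))] := by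
  simp only [c3F, Function.comp_apply, fanoutFn_apply, hHF_apply, vF_apply, eqPairFn_boolPair]

/-- `c4F w = [g(r) = 0^b]`. [folklore] -/
theorem c4F_apply : P.c4F w = [decide (hG (sndF w).length (((fstF w).length - P.Tl (sndF w).length) % ((sndF w).length + 3))
    (P.keyG (sndF w).length (fstF w)) (sndF w) =
      List.replicate (((fstF w).length - P.Tl (sndF w).length) % ((sndF w).length + 3)) false)] := by
  simp only [c4F, Function.comp_apply, fanoutFn_apply, hGF_apply, bF_apply, Kannan.zerosFn_apply, List.length_replicate,
    eqPairFn_boolPair]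

/-- `c5F w = [r_i]`. [folklore] -/
theorem c5F_apply : P.c5F w = [(sndF w).getD (((fstF w).length - P.Tl (sndF w).length) / ((sndF w).length + 3)) false] := by
  simp only [c5F, Function.comp_apply, fanoutFn_apply, iF_apply, dropFn_boolPair, List.length_replicate, headBitFn_apply,
    headD_drop]

/-- The Boolean computed by the checker on `w = ⟨z, r⟩`, `n = |r|`, `(b, i)` from the lengths. [folklore] -/
def chkBool (w : List Bool) : Bool :=
  decide (P.Tl (sndF w).length ≤ (fstF w).length) &&
    (decide (((fstF w).length - P.Tl (sndF w).length) / ((sndF w).length + 3) < (sndF w).length) &&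
      (decide (P.hH (sndF w).length (((fstF w).length - P.Tl (sndF w).length) % ((sndF w).length + 3))
          (P.keyH (sndF w).length (fstF w)) (P.pad (sndF w).length (P.f (sndF w))) =
            P.vf (sndF w).length (((fstF w).length - P.Tl (sndF w).length) % ((sndF w).length + 3)) (fstF w)) &&
        (decide (hG (sndF w).length (((fstF w).length - P.Tl (sndF w).length) % ((sndF w).length + 3))
            (P.keyG (sndF w).length (fstF w)) (sndF w) =
              List.replicate (((fstF w).length - P.Tl (sndF w).length) % ((sndF w).length + 3)) false) &&
          (sndF w).getD (((fstF w).length - P.Tl (sndF w).length) / ((sndF w).length + 3)) false)))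

/-- **The checker's value on every word.** [folklore] -/
theorem chkFn_apply : P.chkFn w = [P.chkBool w] := by
  rw [chkFn, andFn_apply (P.c1F_apply w) (andFn_apply (P.c2F_apply w) (andFn_apply (P.c3F_apply w)
    (andFn_apply (P.c4F_apply w) (P.c5F_apply w))))]
  rfl

/-- **The checker computes the verifier's predicate**: `chkBool w ↔ RelPred z r` for `(z, r)` the
pair decoded from `w`. [Bogdanov–Trevisan 2006, §5.1.3] [folklore] -/
theorem chkBool_eq_true_iff : P.chkBool w = true ↔ P.RelPred (fstF w) (sndF w) := by
  simp only [chkBool, Bool.and_eq_true, decide_eq_true_eq]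
  unfold RelPred
  simp only [dec_eq_some_iff]
  constructor
  · rintro ⟨h1, h2, h3, h4, h5⟩
    exact ⟨_, _, ⟨h1, h2, rfl, rfl⟩, h3, h4, h5⟩
  · rintro ⟨b, i, ⟨h1, h2, hb, hi⟩, h3, h4, h5⟩
    subst hb hi
    exact ⟨h1, h2, h3, h4, h5⟩

end Values

/-! ### `FP` membership and `Rel ∈ P` -/

/-- `uF ∈ FP`. [folklore] -/
theorem uF_mem_FP : uF ∈ FP := comp_mem_FP onesFn_mem_FP sndF_mem_FP
/-- `tlF ∈ FP`. [folklore] -/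
theorem tlF_mem_FP : P.tlF ∈ FP := comp_mem_FP (polyFn_mem_FP _) uF_mem_FP
/-- `dF ∈ FP`. [folklore] -/
theorem dF_mem_FP : P.dF ∈ FP := comp_mem_FP dropFn_mem_FP (fanoutFn_mem_FP P.tlF_mem_FP fstF_mem_FP)
/-- `dmF ∈ FP`. [folklore] -/
theorem dmF_mem_FP : P.dmF ∈ FP :=
  comp_mem_FP divModFn_mem_FP (fanoutFn_mem_FP (comp_mem_FP (polyFn_mem_FP _) uF_mem_FP) (comp_mem_FP onesFn_mem_FP P.dF_mem_FP))
/-- `iF ∈ FP`. [folklore] -/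
theorem iF_mem_FP : P.iF ∈ FP := comp_mem_FP fstF_mem_FP P.dmF_mem_FP
/-- `bF ∈ FP`. [folklore] -/
theorem bF_mem_FP : P.bF ∈ FP := comp_mem_FP sndF_mem_FP P.dmF_mem_FP
/-- `aF ∈ FP`. [folklore] -/
theorem aF_mem_FP : P.aF ∈ FP :=
  comp_mem_FP dropFn_mem_FP (fanoutFn_mem_FP P.bF_mem_FP (comp_mem_FP (polyFn_mem_FP _) uF_mem_FP))
/-- `lhF ∈ FP`. [folklore] -/
theorem lhF_mem_FP : P.lhF ∈ FP := comp_mem_FP (polyFn_mem_FP _) uF_mem_FP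
/-- `lgF ∈ FP`. [folklore] -/
theorem lgF_mem_FP : lgF ∈ FP := comp_mem_FP (polyFn_mem_FP _) uF_mem_FP
/-- `keyHF ∈ FP`. [folklore] -/
theorem keyHF_mem_FP : P.keyHF ∈ FP := comp_mem_FP takeFn_mem_FP (fanoutFn_mem_FP P.lhF_mem_FP fstF_mem_FP)
/-- `keyGF ∈ FP`. [folklore] -/
theorem keyGF_mem_FP : P.keyGF ∈ FP :=
  comp_mem_FP takeFn_mem_FP (fanoutFn_mem_FP lgF_mem_FP (comp_mem_FP dropFn_mem_FP (fanoutFn_mem_FP P.lhF_mem_FP fstF_mem_FP)))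
/-- `vF ∈ FP`. [folklore] -/
theorem vF_mem_FP : P.vF ∈ FP :=
  comp_mem_FP takeFn_mem_FP (fanoutFn_mem_FP P.aF_mem_FP (comp_mem_FP dropFn_mem_FP
    (fanoutFn_mem_FP (comp_mem_FP concatFn_mem_FP (fanoutFn_mem_FP P.lhF_mem_FP lgF_mem_FP)) fstF_mem_FP)))

variable {P}

/-- `padF ∈ FP` for polynomial-time `f`. [folklore] -/
theorem padF_mem_FP (hf : P.f ∈ FP) : P.padF ∈ FP :=
  comp_mem_FP pad10Fn_mem_FP (fanoutFn_mem_FP (comp_mem_FP (polyFn_mem_FP _) uF_mem_FP) (comp_mem_FP hf sndF_mem_FP))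
/-- `hHF ∈ FP` for polynomial-time `f`. [folklore] -/
theorem hHF_mem_FP (hf : P.f ∈ FP) : P.hHF ∈ FP :=
  comp_mem_FP hashFn_mem_FP (fanoutFn_mem_FP (fanoutFn_mem_FP (comp_mem_FP (polyFn_mem_FP _) uF_mem_FP) P.aF_mem_FP)
    (fanoutFn_mem_FP P.keyHF_mem_FP (padF_mem_FP hf)))

variable (P)

/-- `hGF ∈ FP`. [folklore] -/
theorem hGF_mem_FP : P.hGF ∈ FP :=
  comp_mem_FP hashFn_mem_FP (fanoutFn_mem_FP (fanoutFn_mem_FP uF_mem_FP P.bF_mem_FP) (fanoutFn_mem_FP P.keyGF_mem_FP sndF_mem_FP))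
/-- `c1F ∈ FP`. [folklore] -/
theorem c1F_mem_FP : P.c1F ∈ FP := comp_mem_FP (lenLeFn_mem_FP _) (fanoutFn_mem_FP fstF_mem_FP P.tlF_mem_FP)
/-- `c2F ∈ FP`. [folklore] -/
theorem c2F_mem_FP : P.c2F ∈ FP :=
  comp_mem_FP (lenLeFn_mem_FP _) (fanoutFn_mem_FP uF_mem_FP (comp_mem_FP (cons_mem_FP true) P.iF_mem_FP))

variable {P}

/-- `c3F ∈ FP` for polynomial-time `f`. [folklore] -/
theorem c3F_mem_FP (hf : P.f ∈ FP) : P.c3F ∈ FP := comp_mem_FP eqPairFn_mem_FP (fanoutFn_mem_FP (hHF_mem_FP hf) P.vF_mem_FP)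

variable (P)

/-- `c4F ∈ FP`. [folklore] -/
theorem c4F_mem_FP : P.c4F ∈ FP :=
  comp_mem_FP eqPairFn_mem_FP (fanoutFn_mem_FP P.hGF_mem_FP (comp_mem_FP Kannan.zerosFn_mem_FP P.bF_mem_FP))
/-- `c5F ∈ FP`. [folklore] -/
theorem c5F_mem_FP : P.c5F ∈ FP :=
  comp_mem_FP headBitFn_mem_FP (comp_mem_FP dropFn_mem_FP (fanoutFn_mem_FP P.iF_mem_FP sndF_mem_FP))

variable {P}

/-- **The checker is polynomial time** for polynomial-time `f`. [Bogdanov–Trevisan 2006, §5.1.3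
("`M` can be implemented so that … `M` runs in time at most `q(n)`")] [folklore] -/
theorem chkFn_mem_FP (hf : P.f ∈ FP) : P.chkFn ∈ FP :=
  andFn_mem_FP P.c1F_mem_FP (andFn_mem_FP P.c2F_mem_FP (andFn_mem_FP (c3F_mem_FP hf) (andFn_mem_FP P.c4F_mem_FP P.c5F_mem_FP)))

/-- **The verifier relation of `L_f` is in `P`** for polynomial-time `f` (the first efficiency
hypothesis of `not_isOneWay_of_subset_HeurBPP`). [Bogdanov–Trevisan 2006, §5.1.3; Arora–Barak 2009,
Def. 2.1] [cite: BogdanovTrevisan2006, Thm. 29 (ECCC TR06-073 §5.1.3, machine M)] -/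
theorem Rel_mem_P (hf : PolyTimeComputable (id : List Bool → List Bool) (id : List Bool → List Bool) P.f) :
    P.Rel ∈ Classes.P := by
  refine mem_P_of_mem_FP (chkFn_mem_FP hf) P.Rel fun w => ?_
  have h := P.chkFn_apply w
  have hiff := P.chkBool_eq_true_iff w
  change (P.RelPred (fstF w) (sndF w) → _) ∧ (¬ P.RelPred (fstF w) (sndF w) → _)
  rw [h]
  constructor
  · intro hw; rw [hiff.2 hw]
  · intro hw
    cases hb : P.chkBool w
    · rfl
    · exact absurd (hiff.1 hb) hw

/-- **`L_f ∈ NP`** for polynomial-time `f`. [Bogdanov–Trevisan 2006, §5.1.3; Arora–Barak 2009, Def. 2.1]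
[cite: BogdanovTrevisan2006, Thm. 29 (ECCC TR06-073 §5.1.3)] -/
theorem Lang_mem_NP (hf : PolyTimeComputable (id : List Bool → List Bool) (id : List Bool → List Bool) P.f) :
    P.Lang ∈ NP :=
  P.Lang_mem_NP_of (Rel_mem_P hf)

end Params

end ImpagliazzoLevin

end Literature.Computability.Cryptography
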